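import Summits.CriticalPhenomena.PercolationContinuityZ3.Theorems.SahiMasterFamilyGluedFramesZero

/-!
# Glued frames, VI: deletion faces at core-free coordinates are consistent (TIGHTNESS-III Lemma 1.3, bottom point)

Unit `prim-master-conj` (crux anchor stmt-CriticalPhenomena-4575), gen 11; memo HOME/prim-master-conj/TIGHTNESS-III.md §1.3.
`mem_cframe_faceF_iff` (part IV) identifies the canonical frames of a structured deletion face at a core-free coordinate `f` with the sections of
the glued frames at every configuration containing a coordinate `≠ f`.  Here the two remaining configurations (`∅` and `{f}`, on which both
sides do not depend) are handled: a discrepancy forces a glued frame, resp. a face frame, to be "everything non-trivial off `f`", whose block is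
all of `ι ∖ {f}`; with at least three members and support-disjointness some OTHER member then has the trivial frame `univ` and is either sure
(excluded) or — by (F2) — equal to `univ ∖ {∅}`, hence ABSORBING every other member (excluded).  Result:

  **`faceFConsistent_of_noAbsorber`**: `FaceFConsistent U W f` for every core-free `f` with structured deletion face, for families of `≥ 3`
  non-sure members none of which contains all the others.

So hypothesis (c) of THEOREM LG4 (`GluedFrames.lg4`) reduces to "the deletion faces at core-free coordinates are structured", i.e. to
face-vanishing.  Pure combinatorics; axioms standard. [this work]
-/

noncomputable section

open scoped Classical

namespace Summit.CriticalPhenomena.PercolationContinuityZ3.Theorems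

namespace GluedFrames

open Finset Function
open Literature.Probability.LatticeModels.Kahn2022 (Affects)

variable {ι : Type*} [Fintype ι] {κ : Type*} (U : κ → Set (Set ι)) (W : Finset κ)

omit [Fintype ι] in
/-- Deleting twice at the same coordinate is deleting once. [folklore] -/
theorem secAt_false_secAt_false (f : ι) (A : Set (Set ι)) : secAt f false (secAt f false A) = secAt f false A := by
  ext ω
  rw [mem_secAt, mem_secAt, mem_secAt]
  simp only [forceAt, cond_false, _root_.sdiff_idem]

/-- The canonical frames of a structured deletion face ignore the deleted coordinate. [this work] -/
theorem cframe_faceF_ignores (hU : ∀ k, IsUpperSet (U k)) {f : ι} (hf : CoreFree U f) (hF : Structured (faceF U f) W)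
    {w : κ} (hw : w ∈ W) : secAt f false (cframe (faceF U f) W w) = cframe (faceF U f) W w := by
  have hne2 : ∀ k, (secAt f false (faceF U f k)).Nonempty := by
    intro k; rw [faceF_apply, secAt_false_secAt_false]; exact faceF_nonempty U hf k
  have e := cframe_secAt (faceF U f) f false (isUpperSet_faceF U hU f) hne2 hF hw
  have hfam : (fun k => secAt f false (faceF U f k)) = faceF U f := by
    funext k; rw [faceF_apply, secAt_false_secAt_false]
  rw [hfam] at e
  exact e.symm

omit [Fintype ι] in
/-- An increasing event containing every singleton `{h}`, `h ≠ f`, contains every configuration with an element other than `f`. [folklore] -/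
theorem mem_of_singletons {A : Set (Set ι)} (hA : IsUpperSet A) {f : ι} (h1 : ∀ h, h ≠ f → ({h} : Set ι) ∈ A) {ω : Set ι} {h : ι}
    (hh : h ∈ ω) (hhf : h ≠ f) : ω ∈ A :=
  hA (Set.singleton_subset_iff.2 hh) (h1 h hhf)

/-- An increasing event containing every singleton `{h}` (`h ≠ f`) but not `∅` has every `h ≠ f` in its essential support. [folklore] -/
theorem mem_esupp_of_singletons {A : Set (Set ι)} {f : ι} (h1 : ∀ h, h ≠ f → ({h} : Set ι) ∈ A) (h0 : (∅ : Set ι) ∉ A)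
    {h : ι} (hhf : h ≠ f) : h ∈ esupp A :=
  mem_esupp.2 ⟨∅, h0, by simpa using h1 h hhf⟩

/-- **TIGHTNESS-III Lemma 1.3: deletion faces at core-free coordinates are consistent with the glued frames**, for families of at least three
non-sure members with structured contraction faces, support-disjoint glued frames, and no member containing all the others. [this work] -/
theorem faceFConsistent_of_noAbsorber (hU : ∀ k, IsUpperSet (U k)) (hne : ∀ k, (U k).Nonempty) (hns : ∀ k, U k ≠ Set.univ)
    (hS : ∀ h, Structured (faceT U h) W)
    (hd : ∀ w ∈ W, ∀ w' ∈ W, w ≠ w' → Disjoint (esupp (gframe U W w)) (esupp (gframe U W w')))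
    (habs : ∀ l ∈ W, ∃ m ∈ W, m ≠ l ∧ ¬ U m ⊆ U l) (h3 : 3 ≤ W.card)
    {f : ι} (hf : CoreFree U f) (hF : Structured (faceF U f) W) : FaceFConsistent U W f := by
  intro j hj
  set B := cframe (faceF U f) W j with hBdef
  have hΦU := isUpperSet_faceF U hU f
  have hΦne := faceF_nonempty U hf
  have hBup : IsUpperSet B := isUpperSet_cframe (faceF U f) hΦU W j
  have hBf : secAt f false B = B := cframe_faceF_ignores U W hU hf hF hj
  have hgup : IsUpperSet (gframe U W j) := isUpperSet_gframe U W hU j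
  -- agreement off the two configurations `∅`, `{f}`
  have hoff : ∀ ω : Set ι, (∃ h ∈ ω, h ≠ f) → (ω ∈ B ↔ ω ∈ secAt f false (gframe U W j)) :=
    fun ω ⟨h, hh, hhf⟩ => mem_cframe_faceF_iff U W hU hne hS hf hF hj hh hhf
  -- two other members with glued supports inside `{f}` give a member with glued frame `univ`
  have hother : (∀ h, h ≠ f → h ∈ esupp (gframe U W j)) → ∃ l ∈ W, l ≠ j ∧ gframe U W l = Set.univ := by
    intro hbig
    obtain ⟨l₁, hl₁, l₂, hl₂, h12⟩ := one_lt_card.1 (by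
      have := card_erase_of_mem hj; omega : 1 < (W.erase j).card)
    have hsub : ∀ l ∈ W.erase j, esupp (gframe U W l) ⊆ {f} := by
      intro l hl x hx
      rw [mem_singleton]; by_contra hxf
      exact Finset.disjoint_left.1 (hd j hj l (mem_of_mem_erase hl) (ne_of_mem_erase hl).symm) (hbig x hxf) hx
    -- one of `l₁, l₂` has empty glued support
    obtain ⟨l, hl, hempty⟩ : ∃ l ∈ W.erase j, esupp (gframe U W l) = ∅ := by
      by_cases hf1 : f ∈ esupp (gframe U W l₁)
      · refine ⟨l₂, hl₂, eq_empty_of_forall_notMem fun x hx => ?_⟩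
        have := hsub l₂ hl₂ hx; rw [mem_singleton] at this; subst this
        exact Finset.disjoint_left.1 (hd l₁ (mem_of_mem_erase hl₁) l₂ (mem_of_mem_erase hl₂) h12) hf1 hx
      · refine ⟨l₁, hl₁, eq_empty_of_forall_notMem fun x hx => hf1 ?_⟩
        have := hsub l₁ hl₁ hx; rw [mem_singleton] at this; exact this ▸ hx
    refine ⟨l, mem_of_mem_erase hl, ne_of_mem_erase hl, ?_⟩
    rcases eq_empty_or_univ_of_esupp_eq_empty (isUpperSet_gframe U W hU l) hempty with h | h
    · exact absurd h (Set.nonempty_iff_ne_empty.1 ⟨_, subset_gframe U W hU l (univ_mem_of_nonempty (hU l) (hne l))⟩)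
    · exact h
  -- it suffices to compare membership of `∅`
  suffices key : (∅ : Set ι) ∈ B ↔ (∅ : Set ι) ∈ gframe U W j by
    ext ω
    by_cases hω : ∃ h ∈ ω, h ≠ f
    · exact hoff ω hω
    · push Not at hω   -- ω ⊆ {f}
      have hωf : ω \ {f} = ∅ := Set.eq_empty_of_forall_notMem fun x hx => hx.2 (hω x hx.1)
      rw [← hBf, mem_secAt, mem_secAt]
      simp only [forceAt, cond_false, hωf]
      exact key
  constructor
  · -- `∅ ∈ B`: if `∅ ∉ gframe j` then `gframe j` is everything off `f`, some other member has glued frame `univ` and absorbs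
    intro h0B
    by_contra h0g
    have h1 : ∀ h, h ≠ f → ({h} : Set ι) ∈ gframe U W j := by
      intro h hhf
      have : ({h} : Set ι) ∈ B := hBup (Set.empty_subset _) h0B
      have := (hoff {h} ⟨h, rfl, hhf⟩).1 this
      rwa [mem_secAt_false_iff_of_notMem (show f ∉ ({h} : Set ι) from fun e => hhf (Set.mem_singleton_iff.1 e).symm)] at this
    obtain ⟨l, hl, hlj, hgl⟩ := hother fun h hhf => mem_esupp_of_singletons h1 h0g hhf
    -- every non-empty point of `gann l` fails at most the glued frame of `j`: so `gann l ⊆ {∅}`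
    have hNl : ∀ χ ∈ gann U W l, χ = ∅ := by
      intro χ hχ
      by_contra hχne
      have h2 := two_le_card_gfail U W hU hne hS hl hχ (Set.nonempty_iff_ne_empty.2 hχne)
      -- the failing set is inside `{j}`
      have hsub : ((W.erase l).filter fun m => χ ∉ gframe U W m) ⊆ {j} := by
        intro m hm
        rw [mem_filter] at hm
        rw [mem_singleton]
        by_contra hmj
        apply hm.2
        -- `gframe m` (m ≠ j, l) has support inside `{f}`; `χ` agrees with `univ` or with `univ ∖ {f}`... use: χ ∌? we show χ ∈ gframe m directly
        have hmW := mem_of_mem_erase hm.1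
        have hsupp : esupp (gframe U W m) ⊆ {f} := by
          intro x hx; rw [mem_singleton]; by_contra hxf
          exact Finset.disjoint_left.1 (hd j hj m hmW (Ne.symm hmj)) (mem_esupp_of_singletons h1 h0g hxf) hx
        -- χ has an element h ≠ f (else χ ⊆ {f}; then χ = {f} since non-empty, and {f} ∈ gframe m iff univ ∈: both contain f)
        have huniv : Set.univ ∈ gframe U W m :=
          univ_mem_of_nonempty (isUpperSet_gframe U W hU m) ⟨_, subset_gframe U W hU m (univ_mem_of_nonempty (hU m) (hne m))⟩
        by_cases hfχ : f ∈ χ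
        · refine (mem_iff_of_inter_esupp_eq (isUpperSet_gframe U W hU m) (ω := χ) (ω' := Set.univ) ?_).2 huniv
          ext x; simp only [Set.mem_inter_iff, Set.mem_univ, true_and, mem_coe]
          constructor
          · exact fun h => h.2
          · intro hx; have := hsupp hx; rw [mem_singleton] at this; subst this; exact ⟨hfχ, hx⟩
        · -- `f ∉ χ`: then `χ` and `univ ∖ {f}` agree on the support; `univ ∖ {f} ∈ gframe m` (core-free)
          refine (mem_iff_of_inter_esupp_eq (isUpperSet_gframe U W hU m) (ω := χ) (ω' := Set.univ \ {f}) ?_).2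
            (subset_gframe U W hU m (hf m))
          ext x; simp only [Set.mem_inter_iff, Set.mem_sdiff, Set.mem_univ, Set.mem_singleton_iff, true_and, mem_coe]
          constructor
          · rintro ⟨hx, hxs⟩; exact ⟨fun e => hfχ (e ▸ hx), hxs⟩
          · rintro ⟨hxf, hxs⟩; have := hsupp hxs; rw [mem_singleton] at this; exact absurd this hxf
      have := (card_le_card hsub).trans (card_singleton j).le
      omega
    -- so `U l = univ ∖ {∅}` absorbs every other member
    obtain ⟨m, hm, hml, hnot⟩ := habs l hl
    apply hnot
    intro ω hω
    by_contra hωl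
    have hωN : ω ∈ gann U W l := ⟨by rw [hgl]; exact Set.mem_univ _, hωl⟩
    have := hNl ω hωN
    subst this
    exact hns m (Set.eq_univ_of_forall fun ω' => hU m (Set.empty_subset ω') hω)
  · -- `∅ ∈ gframe j`: if `∅ ∉ B` then `B` is everything off `f`, its block is `ι ∖ {f}`, another face frame is `univ` and that member is sure
    intro h0g
    by_contra h0B
    have h1 : ∀ h, h ≠ f → ({h} : Set ι) ∈ B := by
      intro h hhf
      refine (hoff {h} ⟨h, rfl, hhf⟩).2 ?_
      rw [mem_secAt_false_iff_of_notMem (show f ∉ ({h} : Set ι) from fun e => hhf (Set.mem_singleton_iff.1 e).symm)]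
      exact hgup (Set.empty_subset _) h0g
    have hbig : ∀ h, h ≠ f → h ∈ esupp B := fun h hhf => mem_esupp_of_singletons h1 h0B hhf
    -- other face frames have support inside `{f}` and ignore `f`: they are `univ`
    have huniv : ∀ l ∈ W, l ≠ j → cframe (faceF U f) W l = Set.univ := by
      intro l hl hlj
      have hsupp : esupp (cframe (faceF U f) W l) = ∅ := by
        refine eq_empty_of_forall_notMem fun x hx => ?_
        by_cases hxf : x = f
        · subst hxf
          have := not_affects_secAt x false (cframe (faceF U x) W l)
          rw [cframe_faceF_ignores U W hU hf hF hl] at this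
          exact this (mem_esupp.1 hx)
        · exact Finset.disjoint_left.1 (disjoint_esupp_cframe (faceF U f) hΦU hΦne hF hj hl (Ne.symm hlj)) (hbig x hxf) hx
      rcases eq_empty_or_univ_of_esupp_eq_empty (isUpperSet_cframe (faceF U f) hΦU W l) hsupp with h | h
      · exact absurd h (Set.nonempty_iff_ne_empty.1 ⟨_, subset_cframe (faceF U f) hΦU W l (univ_mem_of_nonempty (hΦU l) (hΦne l))⟩)
      · exact h
    -- two pure members of the face; one is not `j`, hence sure after deletion, hence sure
    obtain ⟨a, ha, b, hb, hab, hfa, hfb⟩ := exists_two_pure (faceF U f) hΦU hΦne hF (by omega)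
    obtain ⟨l, hl, hlj, hfl⟩ : ∃ l ∈ W, l ≠ j ∧ cframe (faceF U f) W l = faceF U f l := by
      by_cases haj : a = j
      · exact ⟨b, hb, fun e => hab (haj.trans e.symm), hfb⟩
      · exact ⟨a, ha, haj, hfa⟩
    have : faceF U f l = Set.univ := by rw [← hfl]; exact huniv l hl hlj
    have h0 : (∅ : Set ι) ∈ faceF U f l := by rw [this]; exact Set.mem_univ _
    rw [faceF_apply, mem_secAt] at h0
    simp only [forceAt, cond_false, Set.empty_sdiff] at h0
    exact hns l (Set.eq_univ_of_forall fun ω => hU l (Set.empty_subset ω) h0)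

end GluedFrames

end Summit.CriticalPhenomena.PercolationContinuityZ3.Theorems
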